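import Mathlib
import Summits.Ventures.HodgeRepro2.LevelPositivity

/-!
# m-fold positivity at one level — the counting step of Remark B5.9 (sub-claim B5)

Blind cell `pub-hodge-repro2`, Tier 4 (README §6.1), sub-claim B5 (owner p8; prose in
`route/T4-B5-p8.md`, Remark B5.9). Builds on `LevelPositivity.lean` (p388321).

Kernel-checked here: if a finite set `t` of indices (the prose: `m` distinct pairs `(ε_i, χ^{(j)})`)
each carries a non-zero `K`-invariant vector, then the count `∑ j ∈ s, dim (ω j)^K` over any finite
`s ⊇ t` is `≥ #t` (`card_le_sum_finrank_invariants`), and — combined with the common level of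
`exists_common_level` — for finitely many vertices `i`, each with `m` distinguished indices carrying
non-zero vectors of smooth representations, there is one open compact `K ≤ K₀` at which every count
is `≥ m` (`mFoldPositivity`). What the prose supplies and this file does not: that there ARE `m`
distinct automorphic characters `χ^{(j)}` (Remark B5.9's proviso, from E16/E21), and that the
corresponding `ω(μ_i, ε_i, χ^{(j)})` are non-zero and smooth (Lemma D.1(1), «admissible»).
-/

namespace Summit.Ventures.HodgeRepro2.LevelPositivity

noncomputable section

section Count

variable {G : Type*} [Group G]
variable {k : Type*} [Field k]

/-- Remark B5.9, the counting step: if every index `j ∈ t` carries a non-zero `K`-invariant vector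
`w j` (with finite-dimensional invariants), then `#t ≤ ∑ j ∈ s, dim (ω j)^K` for every finite
`s ⊇ t`. -/
theorem card_le_sum_finrank_invariants {J : Type*} (s t : Finset J) (hts : t ⊆ s) (W : J → Type*)
    [∀ j, AddCommGroup (W j)] [∀ j, Module k (W j)] (ω : ∀ j, Representation k G (W j))
    (K : Subgroup G) (w : ∀ j, W j) (hw : ∀ j ∈ t, w j ≠ 0)
    (hwK : ∀ j ∈ t, w j ∈ invariants (ω j) K)
    [∀ j, FiniteDimensional k (invariants (ω j) K)] :
    t.card ≤ ∑ j ∈ s, Module.finrank k (invariants (ω j) K) := by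
  calc t.card = ∑ j ∈ t, 1 := by simp
    _ ≤ ∑ j ∈ t, Module.finrank k (invariants (ω j) K) :=
        Finset.sum_le_sum fun j hj => one_le_finrank_invariants (ω j) K (hw j hj) (hwK j hj)
    _ ≤ ∑ j ∈ s, Module.finrank k (invariants (ω j) K) :=
        Finset.sum_le_sum_of_subset_of_nonneg hts fun _ _ _ => Nat.zero_le _

end Count

section Main

variable {G : Type*} [Group G] [TopologicalSpace G] [IsTopologicalGroup G]
variable {k : Type*} [Field k]

/-- **Remark B5.9, abstract form (m-fold positivity at one level).** Vertices `i : ι` (finitely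
many), index types `J i`, smooth representations `ω i j`; for each `i` a finite set `t i` of
distinguished indices (the prose: the `m` pairs `(ε_i, χ^{(1)}), …, (ε_i, χ^{(m)})`) and non-zero
vectors `v i j ∈ ω i j` for `j ∈ t i`; an open compact threshold `K₀`; admissibility. Then there is
an open compact `K ≤ K₀` such that at every open compact `K' ≤ K` and every `i`, the count over any
finite `s ⊇ t i` is `≥ #(t i)`. -/
theorem mFoldPositivity {ι : Type*} [Finite ι] (J : ι → Type*) (W : ∀ i, J i → Type*)
    [∀ i j, AddCommGroup (W i j)] [∀ i j, Module k (W i j)]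
    (ω : ∀ i j, Representation k G (W i j)) (hω : ∀ i j, IsSmooth (ω i j))
    (t : ∀ i, Finset (J i)) (v : ∀ i j, W i j) (hv : ∀ i, ∀ j ∈ t i, v i j ≠ 0)
    (K₀ : OpenSubgroup G) (hK₀ : IsCompact (K₀ : Set G))
    (hadm : ∀ i j (K' : OpenSubgroup G), IsCompact (K' : Set G) →
      FiniteDimensional k (invariants (ω i j) K'.toSubgroup)) :
    ∃ K : OpenSubgroup G, IsCompact (K : Set G) ∧ K ≤ K₀ ∧
      ∀ K' : OpenSubgroup G, K' ≤ K → IsCompact (K' : Set G) →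
        ∀ i (s : Finset (J i)), t i ⊆ s →
          (t i).card ≤ ∑ j ∈ s, Module.finrank k (invariants (ω i j) K'.toSubgroup) := by
  -- the finitely many pairs (i, j) with j ∈ t i, and the common level fixing all their vectors
  obtain ⟨K, hKc, hKle, hKfix⟩ :=
    exists_common_level (ι := Σ i, (t i : Set (J i))) (fun p => W p.1 p.2)
      (fun p => ω p.1 p.2) (fun p => hω p.1 p.2) (fun p => v p.1 p.2) K₀ hK₀
  refine ⟨K, hKc, hKle, ?_⟩
  intro K' hK' hK'c i s hts
  haveI : ∀ j, FiniteDimensional k (invariants (ω i j) K'.toSubgroup) :=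
    fun j => hadm i j K' hK'c
  refine card_le_sum_finrank_invariants s (t i) hts (W i) (ω i) K'.toSubgroup (v i)
    (hv i) fun j hj => ?_
  exact hKfix K'.toSubgroup hK' ⟨i, ⟨j, hj⟩⟩

end Main

end

end Summit.Ventures.HodgeRepro2.LevelPositivity
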